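import Literature.AlgebraicGeometry.Frobenioids.BaseFrobeniusSections
import HarnessLib

/-!
# Frobenioids I, Remark 2.7.2 / Proposition 2.9 (ii): the calculus of a base-Frobenius pair

Mochizuki, *The geometry of Frobenioids I: the general theory*, Kyushu J. Math. **62** (2008)
293–400, §2, Remark 2.7.2 p.52 and the proof of Proposition 2.9 (ii) pp.54–55
[cite: MochizukiFrdI2008, Rem. 2.7.2 p.52] [cite: MochizukiFrdI2008, Prop. 2.9(ii) p.54].

For a base-Frobenius pair `(P, F)` of a Frobenioid `C` we record the rules that make the
"`α ∘ β ∘ γ`" calculus of Remark 2.7.2 work between objects of `P` (no skeletality assumed):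
* `frob Fr n hA : A → A`, the component `F(n)_A` (a wrapper keeping statements in `C`);
* `resP`: restriction `O^▷(B) → O^▷(A)` of base-identity linear endomorphisms along a
  `P`-distinguished `α : A → B` (`α ; β = α^*β ; α`, Prop. 1.11 (iii)) — a homomorphism of monoids
  compatible with `Div` (`divHom_resP`) and with `τ` (`resP_mem_tau`);
* `hom_comp_frob`: `α ; F(n)_B = F(n)_A ; α` (naturality of `F(n) ∈ End(P ↪ C)`);
* `endo_comp_frob`: `β ; F(n)_A = F(n)_A ; β^n` (Frobenius-normalisation);
* `existsUnique_factorization`: every `φ : A → B` between objects of `P` is uniquely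
  `F(n)_A ; β ; α` with `β ∈ O^▷(A)` and `α` `P`-distinguished (Remark 2.7.2);
* `factor_comp`: `(F(n₁);β₁;α₁) ; (F(n₂);β₂;α₂) = F(n₂n₁) ; (α₁^*β₂ · β₁^{n₂}) ; (α₁;α₂)` — the
  identity behind "`Ψ` is compatible with composites" on p.55.
-/

noncomputable section

namespace Literature.AlgebraicGeometry.Frobenioids

open CategoryTheory Opposite

universe w v v' u u'

namespace PreFrobenioid

variable {D : Type u} [Category.{v} D] {Φ : Dᵒᵖ ⥤ CommMonCat.{w}}
  {C : Type u'} [Category.{v'} C] {F : C ⥤ ElemFrobenioid Φ}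

namespace BaseFrobeniusPair

/-! ### The components `F(n)_A` -/

section Frob

variable {P : Presection C} (Fr : ℕ+ →* End P.ι)

/-- `F(n)_A : A → A`, the component at `A ∈ Ob(P)` of `F(n) ∈ End(P ↪ C)`.
[cite: MochizukiFrdI2008, Def. 2.7(ii) p.51] -/
def frob (n : ℕ+) {A : C} (hA : P.obj A) : A ⟶ A := (Fr n).app ⟨A, hA⟩

/-- Unfolding `frob`. [cite: MochizukiFrdI2008, Def. 2.7(ii) p.51] -/
theorem frob_def (n : ℕ+) {A : C} (hA : P.obj A) : frob Fr n hA = (Fr n).app ⟨A, hA⟩ := rfl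

/-- `F(n₁)_A ; F(n₂)_A = F(n₂ n₁)_A`. [cite: MochizukiFrdI2008, Def. 2.7(ii) p.51] -/
theorem frob_comp_frob (n₁ n₂ : ℕ+) {A : C} (hA : P.obj A) :
    frob Fr n₁ hA ≫ frob Fr n₂ hA = frob Fr (n₂ * n₁) hA := by
  show (Fr n₁).app ⟨A, hA⟩ ≫ (Fr n₂).app ⟨A, hA⟩ = (Fr (n₂ * n₁)).app ⟨A, hA⟩
  rw [map_mul]; rfl

/-- `F(1)_A = id`. [cite: MochizukiFrdI2008, Def. 2.7(ii) p.51] -/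
theorem frob_one {A : C} (hA : P.obj A) : frob Fr 1 hA = 𝟙 A := by
  show (Fr 1).app ⟨A, hA⟩ = _
  rw [map_one]; rfl

/-- `α ; F(n)_B = F(n)_A ; α` for `P`-distinguished `α` (naturality of `F(n)`).
[cite: MochizukiFrdI2008, Prop. 2.9(ii) p.54] -/
theorem hom_comp_frob (n : ℕ+) {A B : C} (hA : P.obj A) (hB : P.obj B) {α : A ⟶ B} (hα : P.hom α) :
    α ≫ frob Fr n hB = frob Fr n hA ≫ α :=
  (Fr n).naturality (X := (⟨A, hA⟩ : P.Cat)) (Y := (⟨B, hB⟩ : P.Cat)) ⟨α, hα⟩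

/-- `F(n)_A` is `F`-distinguished. [cite: MochizukiFrdI2008, Def. 2.7(ii) p.51] -/
theorem isFDistinguished_frob (n : ℕ+) {A : C} (hA : P.obj A) : IsFDistinguished P Fr (frob Fr n hA) :=
  ⟨hA, n, rfl⟩

/-- An `F`-distinguished endomorphism of `A ∈ Ob(P)` is some `F(n)_A`. [cite: MochizukiFrdI2008, Def. 2.7(ii) p.51] -/
theorem exists_eq_frob {A : C} {γ : A ⟶ A} (h : IsFDistinguished P Fr γ) (hA : P.obj A) :
    ∃ n : ℕ+, γ = frob Fr n hA := by
  obtain ⟨hA', n, rfl⟩ := h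
  exact ⟨n, rfl⟩

variable {Fr} (hFr : IsFrobeniusSection F P Fr)
include hFr

/-- `deg_Fr F(n)_A = n`. [cite: MochizukiFrdI2008, Def. 2.7(ii) p.51] -/
theorem degFr_frob (n : ℕ+) {A : C} (hA : P.obj A) : degFr F (frob Fr n hA) = n := hFr.degFr_eq n ⟨A, hA⟩

/-- `F(n)_A` is a base-identity endomorphism. [cite: MochizukiFrdI2008, Def. 2.7(ii) p.51] -/
theorem base_frob (n : ℕ+) {A : C} (hA : P.obj A) : Base F (frob Fr n hA) = 𝟙 _ := hFr.isBaseIdentity n ⟨A, hA⟩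

/-- `F(n)_A` is of Frobenius type. [cite: MochizukiFrdI2008, Def. 2.7(ii) p.51] -/
theorem isFrobeniusType_frob (n : ℕ+) {A : C} (hA : P.obj A) : IsFrobeniusType F (frob Fr n hA) :=
  hFr.isFrobeniusType n ⟨A, hA⟩

/-- `β ; F(n)_A = F(n)_A ; β^n` for `β ∈ O^▷(A)` (Frobenius-normalisation).
[cite: MochizukiFrdI2008, Prop. 2.9(ii) p.55] -/
theorem endo_comp_frob (hnorm : IsOfType (IsFrobeniusNormalized F)) (n : ℕ+) {A : C} (hA : P.obj A)
    (β : endSubmonoid F A) :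
    (β.1 : A ⟶ A) ≫ frob Fr n hA = frob Fr n hA ≫ ((β ^ (n : ℕ)).1 : A ⟶ A) := by
  have h := hnorm A (frob Fr n hA) (base_frob hFr n hA) β.1 β.2
  dsimp only at h
  rw [degFr_frob hFr n hA] at h
  exact h.symm

end Frob

/-! ### Restriction of `O^▷` along `P`-distinguished arrows -/

section Res

variable (hF : IsFrobenioid F) {P : Presection C} (hP : IsBaseSection F P)
include hF hP

/-- Along a `P`-distinguished (pull-back) morphism `α : A → B`, every `β ∈ O^▷(B)` has a unique
`α^*β ∈ O^▷(A)` with `α ; β = α^*β ; α` (Prop. 1.11 (iii)). [cite: MochizukiFrdI2008, Prop. 1.11(iii) p.36] -/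
theorem existsUnique_res {A B : C} {α : A ⟶ B} (hα : P.hom α) (β : endSubmonoid F B) :
    ∃! β' : endSubmonoid F A, α ≫ (β.1 : B ⟶ B) = (β'.1 : A ⟶ A) ≫ α := by
  have hαpb : IsPullbackMorphism F α := hP.hom_pullback α hα
  obtain ⟨ψ, hψ'⟩ : ∃ ψ : A ⟶ A, pullbackHomMap F α A ψ = ⟨(α ≫ (β.1 : B ⟶ B), 𝟙 _), by
      rw [base_comp, show Base F (β.1 : B ⟶ B) = 𝟙 _ from β.2.1, Category.comp_id, Category.id_comp]⟩ :=
    (hαpb A).2 _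
  have hψ : ψ ≫ α = α ≫ (β.1 : B ⟶ B) := congrArg (fun p : PullbackHomData F α A => p.1.1) hψ'
  have hψb : Base F ψ = 𝟙 _ := congrArg (fun p : PullbackHomData F α A => p.1.2) hψ'
  have hψl : IsLinear F ψ := by
    have hd := congrArg (degFr F) hψ
    rw [degFr_comp, degFr_comp, (hF.iv_b α hαpb).2, β.2.2, mul_one, one_mul] at hd
    exact hd
  refine ⟨⟨ψ, hψb, hψl⟩, hψ.symm, fun β' hβ' => Subtype.ext ((hαpb A).1 (Subtype.ext (Prod.ext ?_ ?_)))⟩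
  · show (β'.1 : A ⟶ A) ≫ α = ψ ≫ α
    rw [hψ]; exact hβ'.symm
  · show Base F (β'.1 : A ⟶ A) = Base F ψ
    rw [hψb]; exact β'.2.1

/-- The function `α^*` (see `resP`). [cite: MochizukiFrdI2008, Prop. 2.9(ii) p.54] -/
def resFun {A B : C} {α : A ⟶ B} (hα : P.hom α) (β : endSubmonoid F B) : endSubmonoid F A :=
  (existsUnique_res hF hP hα β).choose

/-- The defining square of `α^*β`. [cite: MochizukiFrdI2008, Prop. 1.11(iii) p.36] -/
theorem resFun_spec {A B : C} {α : A ⟶ B} (hα : P.hom α) (β : endSubmonoid F B) :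
    α ≫ (β.1 : B ⟶ B) = ((resFun hF hP hα β).1 : A ⟶ A) ≫ α :=
  (existsUnique_res hF hP hα β).choose_spec.1

/-- Uniqueness of `α^*β`. [cite: MochizukiFrdI2008, Prop. 1.11(iii) p.36] -/
theorem resFun_unique {A B : C} {α : A ⟶ B} (hα : P.hom α) (β : endSubmonoid F B) {β' : endSubmonoid F A}
    (h : α ≫ (β.1 : B ⟶ B) = (β'.1 : A ⟶ A) ≫ α) : β' = resFun hF hP hα β :=
  (existsUnique_res hF hP hα β).choose_spec.2 β' h

/-- **`α^* : O^▷(B) → O^▷(A)`** along a `P`-distinguished `α : A → B`, as a homomorphism of monoids.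
[cite: MochizukiFrdI2008, Prop. 2.9(ii) p.54] -/
def resP {A B : C} {α : A ⟶ B} (hα : P.hom α) : endSubmonoid F B →* endSubmonoid F A where
  toFun := resFun hF hP hα
  map_one' := (resFun_unique hF hP hα 1 (by
    show α ≫ 𝟙 B = 𝟙 A ≫ α
    rw [Category.comp_id, Category.id_comp])).symm
  map_mul' β β' := by
    refine (resFun_unique hF hP hα (β * β') ?_).symm
    show α ≫ ((β'.1 : B ⟶ B) ≫ (β.1 : B ⟶ B)) =
      (((resFun hF hP hα β').1 : A ⟶ A) ≫ ((resFun hF hP hα β).1 : A ⟶ A)) ≫ α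
    rw [← Category.assoc, resFun_spec hF hP hα β', Category.assoc, resFun_spec hF hP hα β, Category.assoc]

/-- The defining square `α ; β = α^*β ; α`. [cite: MochizukiFrdI2008, Prop. 1.11(iii) p.36] -/
theorem resP_spec {A B : C} {α : A ⟶ B} (hα : P.hom α) (β : endSubmonoid F B) :
    α ≫ (β.1 : B ⟶ B) = ((resP hF hP hα β).1 : A ⟶ A) ≫ α :=
  resFun_spec hF hP hα β

/-- Uniqueness of `α^*β`. [cite: MochizukiFrdI2008, Prop. 1.11(iii) p.36] -/
theorem resP_unique {A B : C} {α : A ⟶ B} (hα : P.hom α) (β : endSubmonoid F B) {β' : endSubmonoid F A}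
    (h : α ≫ (β.1 : B ⟶ B) = (β'.1 : A ⟶ A) ≫ α) : β' = resP hF hP hα β :=
  resFun_unique hF hP hα β h

/-- `Div(α^*β) = α_D^* Div(β)` (`α` is an isometry of degree `1`). [cite: MochizukiFrdI2008, Prop. 2.2(iii) p.45] -/
theorem divHom_resP {A B : C} {α : A ⟶ B} (hα : P.hom α) (β : endSubmonoid F B) :
    divHom F A (resP hF hP hα β) = pull Φ (Base F α) (divHom F B β) := by
  have hαpb : IsPullbackMorphism F α := hP.hom_pullback α hα
  obtain ⟨⟨-, hαi⟩, hαl⟩ := hF.iv_b α hαpb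
  have h := congrArg (Div F) (resP_spec hF hP hα β)
  rw [div_comp, div_comp, show Div F α = 1 from hαi, one_pow, mul_one, show degFr F α = 1 from hαl,
    PNat.one_coe, pow_one, map_one, one_mul] at h
  exact h.symm

/-- Units restrict to units. [cite: MochizukiFrdI2008, Prop. 2.9(ii) p.54] -/
theorem isUnit_resP {A B : C} {α : A ⟶ B} (hα : P.hom α) {β : endSubmonoid F B} (hβ : IsUnit β) :
    IsUnit (resP hF hP hα β) :=
  hβ.map (resP hF hP hα)

/-- `τ(B)` restricts into `τ(A)` along `P`-distinguished arrows between isotropic objects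
(Def. 2.3, subfunctor condition). [cite: MochizukiFrdI2008, Def. 2.3 p.47] -/
theorem resP_mem_tau (τ : CharacteristicSplitting F) {A B : C} (hA : IsIsotropic F A) (hB : IsIsotropic F B)
    {α : A ⟶ B} (hα : P.hom α) {β : endSubmonoid F B} (hβ : (β.1 : End B) ∈ τ.τ B) :
    ((resP hF hP hα β).1 : End A) ∈ τ.τ A :=
  τ.res_mem hA hB α (hF.iv_b α (hP.hom_pullback α hα)).2 β.1 hβ _ (resP hF hP hα β).2
    (resP_spec hF hP hα β)

/-- `(𝟙)^* = id`. [cite: MochizukiFrdI2008, Prop. 2.9(ii) p.54] -/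
theorem resP_id {A : C} (hA : P.obj A) (β : endSubmonoid F A) : resP hF hP (P.hom_id hA) β = β :=
  (resP_unique hF hP (P.hom_id hA) β (by rw [Category.comp_id, Category.id_comp])).symm

/-- `(α₁ ; α₂)^* = α₁^* ∘ α₂^*`. [cite: MochizukiFrdI2008, Prop. 2.9(ii) p.54] -/
theorem resP_comp {A B E : C} {α₁ : A ⟶ B} {α₂ : B ⟶ E} (h₁ : P.hom α₁) (h₂ : P.hom α₂)
    (β : endSubmonoid F E) :
    resP hF hP (P.hom_comp α₁ α₂ h₁ h₂) β = resP hF hP h₁ (resP hF hP h₂ β) :=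
  (resP_unique hF hP _ β (by
    rw [Category.assoc, resP_spec hF hP h₂ β, ← Category.assoc, resP_spec hF hP h₁, Category.assoc])).symm

end Res

/-! ### The factorization `φ = F(n)_A ; β ; α` (Remark 2.7.2) -/

section Factorization

variable (hF : IsFrobenioid F) {P : Presection C} (hP : IsBaseSection F P)
  {Fr : ℕ+ →* End P.ι} (hFr : IsFrobeniusSection F P Fr)

/-- A factorization datum `(n, β, α)` of an arrow `A → B` between objects of `P`.
[cite: MochizukiFrdI2008, Rem. 2.7.2 p.52] -/
abbrev Factor (P : Presection C) (A B : C) : Type v' := ℕ+ × endSubmonoid F A × {α : A ⟶ B // P.hom α}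

/-- The arrow `F(n)_A ; β ; α` of a factorization datum. [cite: MochizukiFrdI2008, Rem. 2.7.2 p.52] -/
def Factor.toHom (Fr : ℕ+ →* End P.ι) {A B : C} (hA : P.obj A) (t : Factor (F := F) P A B) : A ⟶ B :=
  frob Fr t.1 hA ≫ (t.2.1.1 : A ⟶ A) ≫ t.2.2.1

include hF hP hFr in
/-- **Rmk. 2.7.2** between objects of `P`: every `φ : A → B` is `F(n)_A ; β ; α` for a unique
`(n, β, α)` — `α` the `P`-lift of `Base(φ)`, `F(n)_A ; β` the base-identity factor through the
universal property of `α`, `n = deg_Fr(φ)`, Def. 1.3 (iv)(a) and (ii), total epimorphicity.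
[cite: MochizukiFrdI2008, Rem. 2.7.2 p.52] -/
theorem existsUnique_factorization {A B : C} (hA : P.obj A) (hB : P.obj B) (φ : A ⟶ B) :
    ∃! t : Factor (F := F) P A B, Factor.toHom Fr hA t = φ := by
  have hPF := hF.isPreFrobenioid
  haveI := hP.isEquivalence
  let A' : P.Cat := ⟨A, hA⟩
  let B' : P.Cat := ⟨B, hB⟩
  let αP : A' ⟶ B' := (P.toBase F).preimage (X := A') (Y := B') (Base F φ)
  let α : A ⟶ B := αP.1
  have hα : P.hom α := αP.2
  have hαb : Base F α = Base F φ := (P.toBase F).map_preimage (X := A') (Y := B') (Base F φ)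
  have hαpb : IsPullbackMorphism F α := hP.hom_pullback α hα
  obtain ⟨ψ, hψ'⟩ : ∃ ψ : A ⟶ A, pullbackHomMap F α A ψ = ⟨(φ, 𝟙 _), by rw [hαb, Category.id_comp]⟩ :=
    (hαpb A).2 _
  have hψ : ψ ≫ α = φ := congrArg (fun p : PullbackHomData F α A => p.1.1) hψ'
  have hψb : Base F ψ = 𝟙 _ := congrArg (fun p : PullbackHomData F α A => p.1.2) hψ'
  -- `ψ = F(n)_A ; β`
  obtain ⟨X, Y, γ', β', α', hfac, hγ', hβ', hα'⟩ := hF.iv_a_exists ψ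
  have hdeg : degFr F γ' = degFr F ψ := by
    conv_rhs => rw [← hfac]
    rw [degFr_comp, degFr_comp, hβ'.1, (hF.iv_b α' hα').2, mul_one, mul_one]
  set n : ℕ+ := degFr F ψ with hn
  let γ : A ⟶ A := frob Fr n hA
  obtain ⟨e, he⟩ := hF.ii_unique γ' γ hγ' (isFrobeniusType_frob hFr n hA)
    (hdeg.trans (degFr_frob hFr n hA).symm)
  let β : A ⟶ A := e.inv ≫ β' ≫ α'
  have hγβ : γ ≫ β = ψ := by
    show γ ≫ e.inv ≫ β' ≫ α' = ψ
    rw [← he, Category.assoc, e.hom_inv_id_assoc, hfac]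
  have hβb : IsBaseIdentity F β := by
    have h := congrArg (Base F) hγβ
    rw [base_comp, base_frob hFr n hA, Category.id_comp, hψb] at h
    exact h
  have hβl : IsLinear F β := by
    show degFr F (e.inv ≫ β' ≫ α') = 1
    rw [degFr_comp, degFr_comp, isLinear_of_isIso F e.inv, hβ'.1, (hF.iv_b α' hα').2, one_mul, one_mul]
  refine ⟨(n, ⟨β, hβb, hβl⟩, ⟨α, hα⟩), ?_, ?_⟩
  · show γ ≫ β ≫ α = φ
    rw [← Category.assoc, hγβ, hψ]
  rintro ⟨n₁, β₁, α₁⟩ hfac₁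
  change frob Fr n₁ hA ≫ (β₁.1 : A ⟶ A) ≫ α₁.1 = φ at hfac₁
  -- `α₁ = α`
  have hα₁eq : α₁.1 = α := by
    have hb : Base F α₁.1 = Base F φ := by
      rw [← hfac₁, base_comp, base_comp, base_frob hFr n₁ hA, show Base F (β₁.1 : A ⟶ A) = 𝟙 _ from β₁.2.1,
        Category.id_comp, Category.id_comp]
    have : (⟨α₁.1, α₁.2⟩ : A' ⟶ B') = αP :=
      (P.toBase F).map_injective (X := A') (Y := B') (hb.trans hαb.symm)
    exact congrArg Subtype.val this
  -- `F(n₁) ; β₁ = ψ`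
  have hψ₁ : frob Fr n₁ hA ≫ (β₁.1 : A ⟶ A) = ψ := by
    refine (hαpb A).1 (Subtype.ext (Prod.ext ?_ ?_))
    · show (frob Fr n₁ hA ≫ (β₁.1 : A ⟶ A)) ≫ α = ψ ≫ α
      rw [hψ, Category.assoc, ← hfac₁, hα₁eq]
    · show Base F (frob Fr n₁ hA ≫ (β₁.1 : A ⟶ A)) = Base F ψ
      rw [base_comp, base_frob hFr n₁ hA, show Base F (β₁.1 : A ⟶ A) = 𝟙 _ from β₁.2.1, hψb,
        Category.id_comp]
  -- `n₁ = n`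
  have hn₁ : n₁ = n := by
    have hd := congrArg (degFr F) hψ₁
    rw [degFr_comp, degFr_frob hFr n₁ hA, show degFr F (β₁.1 : A ⟶ A) = 1 from β₁.2.2, mul_one] at hd
    exact hd
  subst hn₁
  -- `β₁ = β`
  have hβ₁ : β = (β₁.1 : A ⟶ A) := by
    haveI := hPF.isTotallyEpimorphic.epi γ
    rw [← cancel_epi γ, hγβ]
    exact hψ₁.symm
  have hβ₁' : β₁ = ⟨β, hβb, hβl⟩ := Subtype.ext hβ₁.symm
  have hα₁' : α₁ = ⟨α, hα⟩ := Subtype.ext hα₁eq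
  rw [hβ₁', hα₁']

include hFr in
/-- The factorization of a composite: `(F(n₁);β₁;α₁) ; (F(n₂);β₂;α₂) = F(n₂n₁) ; (α₁^*β₂ · β₁^{n₂}) ;
(α₁;α₂)`. [cite: MochizukiFrdI2008, Prop. 2.9(ii) p.55] -/
theorem factor_comp (hnorm : IsOfType (IsFrobeniusNormalized F)) {A B E : C} (hA : P.obj A) (hB : P.obj B)
    (n₁ n₂ : ℕ+) (β₁ : endSubmonoid F A) (β₂ : endSubmonoid F B) {α₁ : A ⟶ B} (h₁ : P.hom α₁) (α₂ : B ⟶ E) :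
    (frob Fr n₁ hA ≫ (β₁.1 : A ⟶ A) ≫ α₁) ≫ (frob Fr n₂ hB ≫ (β₂.1 : B ⟶ B) ≫ α₂) =
      frob Fr (n₂ * n₁) hA ≫ ((resP hF hP h₁ β₂ * β₁ ^ (n₂ : ℕ)).1 : A ⟶ A) ≫ (α₁ ≫ α₂) := by
  rw [← frob_comp_frob Fr n₁ n₂ hA, Submonoid.coe_mul, End.mul_def]
  simp only [Category.assoc]
  rw [← Category.assoc α₁, hom_comp_frob Fr n₂ hA hB h₁, Category.assoc,
    ← Category.assoc (β₁.1 : A ⟶ A), endo_comp_frob hFr hnorm n₂ hA β₁, Category.assoc,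
    ← Category.assoc α₁, resP_spec hF hP h₁ β₂, Category.assoc]

end Factorization

end BaseFrobeniusPair

end PreFrobenioid

end Literature.AlgebraicGeometry.Frobenioids
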